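import Summits.BirchSwinnertonDyer.Rank1Residual.X11b.BDPRouteDescent
import Literature.NumberTheory.EllipticCurves.ModularCurveManinConstantProofs
import HarnessLib

/-!
# CGLS22, proof of Thm. 5.3.1, display (5.6) `p`-adically: the Gross–Zagier bookkeeping
# `ord_p q + ord_p q_d = 2·ord_p [E(K):ℤP] − 2·ord_p c_E − 2·ord_p #E(K)_tors` for ANY rank-one `E/ℚ`

HONEST FRAMING (cell `b2b-bsdres`, run/shared/lean/b2b/bsd-rank1-residual/; verbatim): the goal is to
DELETE the COMBINATION-SHAPED residual classes for ALL analytic-rank `≤ 1` curves over `ℚ` — "full BSD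
formula for every rank `≤ 1` curve in class `C`" assembled STRICTLY from published theorems — so
that the rank-`≤ 1` remainder becomes exactly the CONSTRUCTION-SHAPED classes, which are TYPED
(missing-input `Prop`s), NOT attempted; this is not "finishing BSD". NEW WORK of the cell (bookkeeping
over decls already in the tree), hence under `Summits/`; NO definition, NO named fact, nothing about
any particular curve asserted; no label moves. Unit `b2b-bsdres-lit-cgls` (off-peak literature typer:
Castella–Grossi–Lee–Skinner 2022 / Greenberg–Vatsal 2000), session 4.

## What this file does

In the proof of CGLS22 Thm. 5.3.1 the passage from (5.5) (the Heegner-index identity OVER `K`, typed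
as `CastellaGrossiLeeSkinner2022.display55_sha_heegnerIndex`, A157) to (5.7) (the twist identity OVER
`ℚ`, typed as `…display57_rankOne_twist`, A149) is "(5.6)": the Gross–Zagier formula rewritten as
`L'(E,1)/(Reg(E/ℚ)·Ω_E) · L(E^K,1)/Ω_{E^K} = 2^t c_E⁻² u_K⁻² [E(K):ℤ.P_K]²` (up to the torsion index),
using `L(E/K,s) = L(E,s)·L(E^K,s)`, the period relation and the height–index relation. This file
proves (5.6) `p`-ADICALLY and EXACTLY (torsion included), for ANY elliptic `E/ℚ` with
`ord_{s=1}L(E,s) = 1` — no reducibility, no Eisenstein hypothesis —, at a Heegner datum over an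
imaginary quadratic `K`:

* `TwistIdentity.padicValRat_add_eq_of_grossZagier`: for `q = L'(E,1)/(Ω_E·Reg)` and
  `q_d = L(E^{(d_K)},1)/Ω`, `ord_p q + ord_p q_d = 2·ord_p [E(K):ℤP] − 2·ord_p c(Dt) − 2·ord_p #E(K)_tors`
  (`p` odd, `p ∤ #𝓞_K^×`, `ord_p u(Cd) = 0` for the chosen minimal model `Wd = Cd • E^{(d_K)}`).

Inputs (binders, named facts of the tree): Gross–Zagier (`gross_zagier`), Kolyvagin (`kolyvagin`;
rank `E(K) = 1`), GZK over `ℚ`, modularity (`hasEntireLFunction_rat`). The real-number algebra is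
the transcript of `X11b.bsdp_of_indexIdentityAt` (multr1-p2) / `KrizLi2019/SexticTwistBSDThreeDescent`
(Gross–Zagier V.§2, Jetchev–Skinner–Wan §7.4.1 made exact), STOPPED one step earlier — before any
identity over `K` is inserted —, so it is the half of that descent which depends on no main
conjecture. Consumer: `Partition/MainConjecturesEisensteinTwistIdentity.lean` ((5.5) ⇒ (5.7)).

References: [CastellaGrossiLeeSkinner2022] proof of Thm. 5.3.1, (5.6) (TeX `eq:GZ`), §5.1.2;
[GrossZagier1986] I.(6.5), V.§2 (pp. 310–312); [JetchevSkinnerWan2017] §7.4.1 (eq:gz for K′);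
[Gross1991] Thm. 1.3; [CaiShuTian2014] Thm. 1.1. Deliverable: HOME/b2b-bsdres-lit-cgls/CGLS-GV-TYPING.md §11.
-/

set_option autoImplicit false

noncomputable section

open scoped Classical

open WeierstrassCurve NumberField Literature.NumberTheory.EllipticCurves
  Literature.NumberTheory.EllipticCurves.ModularForms Literature.NumberTheory.QuadraticFields
  Literature.NumberTheory.EllipticCurves.Rank1Residual
  Literature.NumberTheory.EllipticCurves.KrizLi2019

namespace Summit.BirchSwinnertonDyer.Rank1Residual

/-! ### §1 (5.6) `p`-adically: the Gross–Zagier bookkeeping for ANY rank-one `E/ℚ` at a Heegner datum -/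

/-- **(5.6) of the proof of CGLS22 Thm. 5.3.1, `p`-adically, for ANY elliptic `E/ℚ` with
`ord_{s=1}L(E,s) = 1`:** `ord_p q + ord_p q_d = 2·ord_p [E(K):ℤP] − 2·ord_p c(Dt) − 2·ord_p #E(K)_tors`
for `q = L'(E,1)/(Ω_E·Reg(E/ℚ))` and `q_d = L(E^{(d_K)},1)/Ω_{E^{(d_K)}}`. Data: `W/ℚ` globally minimal
of conductor `N`; `K` imaginary quadratic with the Heegner hypothesis for `N` and `L(E^{(d_K)},1) ≠ 0`;
`P ∈ E(K)` the Heegner point of the parametrisation datum `Dt` (Manin constant `Dt.c`, KEPT);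
`p` odd with `p ∤ #𝓞_K^×` (`hμ`); `Wd = Cd • E^{(d_K)}` globally minimal with `ord_p u(Cd) = 0` (`hu`).
PUBLISHED inputs as binders: Gross–Zagier `L'(E/K,1) = (2·covol/(c²(w/2)²√|d_K|))·ĥ(P)` (`hGZ`),
Kolyvagin (`hKo`: rank `E(K) = 1`), GZK over `ℚ` (`hGZK`: rank `E(ℚ) = 1`, rank `E^K(ℚ) = 0`),
modularity (`hmod`: `L(E/K,s) = L(E,s)·L(E^K,s)`). Computation (Gross–Zagier V.§2 / JSW §7.4.1, exact):
`q = 8 I²/(n m t_K² c² w² q_d |u|)` with `I = [E(K):ℤP]`, `n = [E(ℝ):E(ℝ)⁰]`, `m ∈ {1,4}`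
(`m·t_K²·ĥ(P) = 2 I² Reg`), `w = #𝓞_K^×`, `Ω_E Ω_{E^D} = n·B` (`B` the period of `E/K`),
`Ω(Wd) = |u|·Ω(E^{(d_K)})`; then take `ord_p`. The real-number algebra is the transcript of
`X11b.bsdp_of_indexIdentityAt` (multr1-p2), stopped before the identity over `K` is inserted — so
this is the HALF of that descent which does not depend on any main conjecture.
[cite: CastellaGrossiLeeSkinner2022, proof of Thm. 5.3.1, display (5.6) (TeX `eq:GZ`)]
[cite: GrossZagier1986, I.(6.5) and V.§2 (pp. 310–312)] [cite: JetchevSkinnerWan2017, §7.4.1 (eq:gz for K′), p. 30] -/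
theorem TwistIdentity.padicValRat_add_eq_of_grossZagier
    (W : WeierstrassCurve ℚ) [W.IsElliptic] [W.IsGloballyMinimal] (p : ℕ) [Fact p.Prime]
    (N : ℕ) [NeZero N] (K : Type) [Field K] [NumberField K]
    (Dt : ModularParametrizationData W N) (H : HeegnerDatum N (NumberField.discr K)) (ι : K →+* ℂ)
    (P : (W.baseChange K).toAffine.Point)
    -- the published inputs (named facts of the tree)
    (hGZ : gross_zagier N W K) (hKo : kolyvagin N W K)
    (hGZK : rank_eq_analyticRank_of_analyticRank_le_one) (hmod : hasEntireLFunction_rat)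
    -- the data
    (hK : IsImaginaryQuadratic K) (hHN : SatisfiesHeegnerHypothesis N K)
    (hP : WeierstrassCurve.Affine.Point.map ι.toRatAlgHom P = heegnerPointComplex Dt H)
    (hp2 : p ≠ 2) (hμ : ¬ p ∣ Units.torsionOrder K) (hr : W.analyticRank = 1)
    (hLt : (W.quadraticTwist (NumberField.discr K : ℚ)).entireLFunction 1 ≠ 0)
    -- a globally minimal model of the quadratic twist by `d_K`
    (Wd : WeierstrassCurve ℚ) [Wd.IsElliptic] [Wd.IsGloballyMinimal] (Cd : VariableChange ℚ)
    (hWd : Cd • W.quadraticTwist (NumberField.discr K : ℚ) = Wd) (hu : padicValRat p (Cd.u : ℚ) = 0)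
    -- the two rationals of (5.7)
    (q qd : ℚ) (hq : W.leadingLCoeff / ((W.realPeriodRat * W.regulator : ℝ) : ℂ) = (q : ℂ))
    (hqd : Wd.entireLFunction 1 / (Wd.realPeriodRat : ℂ) = (qd : ℂ)) :
    padicValRat p q + padicValRat p qd =
      2 * (padicValNat p (AddSubgroup.zmultiples P).index : ℤ) - 2 * (padicValInt p Dt.c : ℤ) -
        2 * (padicValNat p (W.baseChange K).torsionOrder : ℤ) := by
  have hpp : p.Prime := Fact.out
  haveI hEK : (W.baseChange K).IsElliptic := isElliptic_baseChange' W K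
  obtain ⟨h2, hKtc⟩ := hK
  haveI : IsTotallyComplex K := hKtc
  have hD0 : (NumberField.discr K : ℚ) ≠ 0 := by exact_mod_cast NumberField.discr_ne_zero K
  haveI hEt : (W.quadraticTwist (NumberField.discr K : ℚ)).IsElliptic :=
    W.isElliptic_quadraticTwist hD0
  ---------------------------------------------------------------- `L`-values over `ℚ` and `K`
  have hL0 : W.entireLFunction 1 = 0 := entireLFunction_one_eq_zero_of_analyticRank_eq_one hr
  obtain ⟨hlead, hderiv⟩ := leadingLCoeff_eq_deriv_of_analyticRank_eq_one hr
  have hprod := lDerivEK_eq_deriv_mul W K hmod hL0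
  have hLK : LDerivEK W K ≠ 0 := by
    rw [hprod]; exact mul_ne_zero hderiv hLt
  ---------------------------------------------------------------- the Heegner point is non-torsion; Kolyvagin
  have hPH : IsHeegnerPoint N W K P := ⟨Dt, H, ι, hP⟩
  have hPinf : ¬ IsOfFinAddOrder P :=
    (lDerivEK_ne_zero_iff_not_isOfFinAddOrder W N K hGZ ⟨h2, hKtc⟩ hHN hPH).mp hLK
  obtain ⟨hrkK, -⟩ := hKo ⟨h2, hKtc⟩ hHN hPH hPinf
  ---------------------------------------------------------------- analytic ranks, GZK for `W` and `Wd`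
  have hrt : (W.quadraticTwist (NumberField.discr K : ℚ)).analyticRank = 0 :=
    ((W.quadraticTwist _).analyticRank_eq_zero_iff_holds (hmod _)).2 hLt
  have hrd : Wd.analyticRank = 0 := by rw [← hWd, analyticRank_smul, hrt]
  have hr1 : W.analyticRank ≤ 1 := le_of_eq hr
  have hrQ : W.mordellWeilRank = 1 := by rw [(hGZK W hr1).1, hr]
  have hrd1 : Wd.analyticRank ≤ 1 := by omega
  obtain ⟨hrankd, -⟩ := hGZK Wd hrd1
  have hrkd : Wd.mordellWeilRank = 0 := by rw [hrankd, hrd]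
  haveI hfind : Finite Wd.toAffine.Point := Wd.mordellWeilRank_eq_zero_iff_holds.mp hrkd
  ---------------------------------------------------------------- heights and index (Kriz–Li §2)
  obtain ⟨m, hm, hheight⟩ :=
    exists_mul_canonicalHeight_eq_index_sq_mul_regulator W K h2 hrkK hrQ P hPinf
  ---------------------------------------------------------------- Gross–Zagier and the period
  have hLD := (hGZ ⟨h2, hKtc⟩ hHN) Dt H ι P hP
  have hper := two_mul_covolume_div_sqrt_eq_bsdPeriod W K Dt h2
  have hΩ := W.realPeriod_mul_realPeriod_quadraticTwist_eq_mul_bsdPeriod K h2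
  have hΩd : Wd.realPeriodRat =
      |((Cd.u : ℚ) : ℝ)| * (W.quadraticTwist (NumberField.discr K : ℚ)).realPeriodRat := by
    rw [← hWd]; exact realPeriodRat_smul_holds (W.quadraticTwist _) Cd
  have hLt' : (W.quadraticTwist (NumberField.discr K : ℚ)).entireLFunction = Wd.entireLFunction := by
    rw [← hWd, entireLFunction_smul]
  ---------------------------------------------------------------- the twist's `L`-value
  have hΩdpos : 0 < Wd.realPeriodRat := Wd.realPeriodRat_pos_holds
  have hΩdC : (Wd.realPeriodRat : ℂ) ≠ 0 := by exact_mod_cast hΩdpos.ne'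
  have hLd : Wd.entireLFunction 1 = (((qd : ℝ) * Wd.realPeriodRat : ℝ) : ℂ) := by
    have := (div_eq_iff hΩdC).mp hqd
    rw [this]; push_cast; ring
  have hLd1 : Wd.entireLFunction 1 ≠ 0 := by rw [← hLt']; exact hLt
  have hqd0 : qd ≠ 0 := by
    intro h0
    apply hLd1
    rw [hLd, h0]; simp
  ---------------------------------------------------------------- positivity of everything
  have hΩW : 0 < W.realPeriodRat := W.realPeriodRat_pos_holds
  have hΩt : 0 < (W.quadraticTwist (NumberField.discr K : ℚ)).realPeriodRat :=
    (W.quadraticTwist _).realPeriodRat_pos_holds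
  have hR : 0 < W.regulator := W.regulator_pos'
  have htK : 0 < (W.baseChange K).torsionOrder := (W.baseChange K).torsionOrder_pos_holds
  have hcM0 : Dt.c ≠ 0 := Dt.maninConstant_ne_zero_holds
  have hcM : (Dt.c : ℚ) ≠ 0 := by exact_mod_cast hcM0
  have hw : 0 < Units.torsionOrder K := Units.torsionOrder_pos K
  have huu : (Cd.u : ℚ) ≠ 0 := Cd.u.ne_zero
  have hm0 : 0 < m := by rcases hm with rfl | rfl <;> norm_num
  have hI0 : (AddSubgroup.zmultiples P).index ≠ 0 := by
    intro hI
    rw [hI] at hheight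
    have h0 : (m : ℝ) * ((W.baseChange K).torsionOrder : ℝ) ^ 2 * P.canonicalHeight = 0 := by
      rw [hheight]; simp
    have hh0 : P.canonicalHeight = 0 := by
      rcases mul_eq_zero.mp h0 with h' | h'
      · rcases mul_eq_zero.mp h' with h'' | h''
        · exact absurd (by exact_mod_cast h'' : m = 0) hm0.ne'
        · exact absurd (pow_eq_zero_iff two_ne_zero |>.mp h'') (by exact_mod_cast htK.ne')
      · exact h'
    exact hPinf ((Affine.Point.canonicalHeight_eq_zero_iff_holds P).mp hh0)
  set n := (W.baseChange ℝ).numRealComponents with hn_def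
  have hn : n = 1 ∨ n = 2 := numRealComponents_eq_one_or W
  have hn0 : 0 < n := by rcases hn with h' | h' <;> omega
  ---------------------------------------------------------------- the rational number `Q = q`
  set I := (AddSubgroup.zmultiples P).index with hI_def
  set Q : ℚ := 8 * (I : ℚ) ^ 2 /
      ((n : ℚ) * (m : ℚ) * ((W.baseChange K).torsionOrder : ℚ) ^ 2 * (Dt.c : ℚ) ^ 2 *
        (Units.torsionOrder K : ℚ) ^ 2 * qd * |(Cd.u : ℚ)|) with hQ_def
  ---------------------------------------------------------------- real abbreviations
  set ΩW := W.realPeriodRat with hΩW_def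
  set Ωt := (W.quadraticTwist (NumberField.discr K : ℚ)).realPeriodRat with hΩt_def
  set B := (W.baseChange K).bsdPeriod with hB_def
  set R := W.regulator with hR_def
  set hh := P.canonicalHeight with hhh_def
  set tK := (W.baseChange K).torsionOrder with htK_def
  set w := Units.torsionOrder K with hw_def
  set cM := Dt.c with hcM_def
  set u := (Cd.u : ℚ) with hu_def
  have hΩW' : ΩW = (W.baseChange ℝ).realPeriod := rfl
  have hΩt' : Ωt = ((W.quadraticTwist (NumberField.discr K : ℚ)).baseChange ℝ).realPeriod := rfl
  rw [← hΩW', ← hΩt'] at hΩ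
  -- `B = ΩW Ωt / n`, `ĥ = 2 I² R / (m tK²)`, the Gross–Zagier constant `= 4 B / (c² w²)`
  have hBeq : B = ΩW * Ωt / n := by
    rw [hΩ]; field_simp
  have hheq : hh = 2 * (I : ℝ) ^ 2 * R / ((m : ℝ) * (tK : ℝ) ^ 2) := by
    rw [← hheight]; field_simp
  have hGZc : 2 * ZLattice.covolume Dt.L.lattice /
        ((cM : ℝ) ^ 2 * ((w : ℝ) / 2) ^ 2 * √|(NumberField.discr K : ℝ)|) =
      4 * B / ((cM : ℝ) ^ 2 * (w : ℝ) ^ 2) := by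
    rw [← hper]; field_simp; ring
  -- the `L`-values as real numbers
  have hLdr : Wd.entireLFunction 1 = (((qd : ℝ) * (|(u : ℝ)| * Ωt) : ℝ) : ℂ) := by
    rw [hLd, hΩd]
  have hLdne : ((qd : ℝ) * (|(u : ℝ)| * Ωt) : ℝ) ≠ 0 := by
    have hu' : |(u : ℝ)| ≠ 0 := abs_ne_zero.mpr (by exact_mod_cast huu)
    have hqd' : (qd : ℝ) ≠ 0 := by exact_mod_cast hqd0
    exact mul_ne_zero hqd' (mul_ne_zero hu' hΩt.ne')
  set X : ℝ := (4 * B / ((cM : ℝ) ^ 2 * (w : ℝ) ^ 2) * hh) / ((qd : ℝ) * (|(u : ℝ)| * Ωt))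
    with hX_def
  have hL1 : deriv W.entireLFunction 1 = ((X : ℝ) : ℂ) := by
    have hne : ((((qd : ℝ) * (|(u : ℝ)| * Ωt) : ℝ)) : ℂ) ≠ 0 := by exact_mod_cast hLdne
    have key : deriv W.entireLFunction 1 * ((((qd : ℝ) * (|(u : ℝ)| * Ωt) : ℝ)) : ℂ) =
        ((4 * B / ((cM : ℝ) ^ 2 * (w : ℝ) ^ 2) * hh : ℝ) : ℂ) := by
      rw [← hLdr, ← hLt', ← hprod, hLD, hGZc]
    rw [hX_def, Complex.ofReal_div, ← key, mul_div_cancel_right₀ _ hne]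
  -- `X / (ΩW R) = Q`
  have hXQ : X / (ΩW * R) = (Q : ℝ) := by
    have hn' : (n : ℝ) ≠ 0 := by exact_mod_cast hn0.ne'
    have hm' : (m : ℝ) ≠ 0 := by exact_mod_cast hm0.ne'
    have htK' : (tK : ℝ) ≠ 0 := by exact_mod_cast htK.ne'
    have hcM' : (cM : ℝ) ≠ 0 := by exact_mod_cast hcM0
    have hw' : (w : ℝ) ≠ 0 := by exact_mod_cast hw.ne'
    have hu' : |(u : ℝ)| ≠ 0 := abs_ne_zero.mpr (by exact_mod_cast huu)
    have hqd' : (qd : ℝ) ≠ 0 := by exact_mod_cast hqd0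
    have hΩW0 : ΩW ≠ 0 := hΩW.ne'
    have hΩt0 : Ωt ≠ 0 := hΩt.ne'
    have hR0 : R ≠ 0 := hR.ne'
    rw [hX_def, hheq, hBeq, hQ_def]
    push_cast
    field_simp
    ring
  have hqQ : q = Q := by
    have h3 : (q : ℂ) = ((Q : ℚ) : ℂ) := by
      rw [← hq, hlead, hL1, ← Complex.ofReal_div, hXQ]
      norm_cast
    exact_mod_cast h3
  ---------------------------------------------------------------- `p`-adic valuations
  have hI' : (I : ℚ) ≠ 0 := by exact_mod_cast hI0
  have htKq : (tK : ℚ) ≠ 0 := by exact_mod_cast htK.ne'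
  have hn' : (n : ℚ) ≠ 0 := by exact_mod_cast hn0.ne'
  have hm' : (m : ℚ) ≠ 0 := by exact_mod_cast hm0.ne'
  have hw' : (w : ℚ) ≠ 0 := by exact_mod_cast hw.ne'
  have hua : |u| ≠ 0 := abs_ne_zero.mpr huu
  have h8 : padicValRat p (8 : ℚ) = 0 := by
    rw [show (8 : ℚ) = ((8 : ℕ) : ℚ) by norm_num, padicValRat.of_nat]
    have : ¬ p ∣ 8 := by
      intro h
      have h' : p ∣ 2 ^ 3 := by simpa using h
      exact hp2 ((Nat.prime_dvd_prime_iff_eq hpp Nat.prime_two).mp (hpp.dvd_of_dvd_pow h'))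
    simp [padicValNat.eq_zero_of_not_dvd this]
  have hvn : padicValRat p (n : ℚ) = 0 := by
    rw [padicValRat.of_nat]
    have : ¬ p ∣ n := by
      rcases hn with h' | h'
      · rw [h']; exact hpp.one_lt.ne' ∘ Nat.dvd_one.mp
      · rw [h']; intro hd; exact hp2 ((Nat.prime_dvd_prime_iff_eq hpp Nat.prime_two).mp hd)
    simp [padicValNat.eq_zero_of_not_dvd this]
  have hvm : padicValRat p (m : ℚ) = 0 := by
    rw [padicValRat.of_nat]
    have : ¬ p ∣ m := by
      rcases hm with rfl | rfl
      · exact hpp.one_lt.ne' ∘ Nat.dvd_one.mp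
      · intro hd
        have h' : p ∣ 2 ^ 2 := by simpa using hd
        exact hp2 ((Nat.prime_dvd_prime_iff_eq hpp Nat.prime_two).mp (hpp.dvd_of_dvd_pow h'))
    simp [padicValNat.eq_zero_of_not_dvd this]
  have hvw : padicValRat p (w : ℚ) = 0 := by
    rw [padicValRat.of_nat, padicValNat.eq_zero_of_not_dvd hμ]; rfl
  have hvu : padicValRat p |u| = 0 := by
    rcases abs_choice u with h' | h'
    · rw [h']; exact hu
    · rw [h', padicValRat.neg]; exact hu
  -- nonvanishing of the partial products
  have hA1 : (8 : ℚ) * (I : ℚ) ^ 2 ≠ 0 := mul_ne_zero (by norm_num) (pow_ne_zero _ hI')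
  have hD1 : (n : ℚ) * (m : ℚ) ≠ 0 := mul_ne_zero hn' hm'
  have hD2 : (n : ℚ) * (m : ℚ) * (tK : ℚ) ^ 2 ≠ 0 := mul_ne_zero hD1 (pow_ne_zero _ htKq)
  have hD3 : (n : ℚ) * (m : ℚ) * (tK : ℚ) ^ 2 * (cM : ℚ) ^ 2 ≠ 0 :=
    mul_ne_zero hD2 (pow_ne_zero _ hcM)
  have hD4 : (n : ℚ) * (m : ℚ) * (tK : ℚ) ^ 2 * (cM : ℚ) ^ 2 * (w : ℚ) ^ 2 ≠ 0 :=
    mul_ne_zero hD3 (pow_ne_zero _ hw')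
  have hD5 : (n : ℚ) * (m : ℚ) * (tK : ℚ) ^ 2 * (cM : ℚ) ^ 2 * (w : ℚ) ^ 2 * qd ≠ 0 :=
    mul_ne_zero hD4 hqd0
  have hD6 : (n : ℚ) * (m : ℚ) * (tK : ℚ) ^ 2 * (cM : ℚ) ^ 2 * (w : ℚ) ^ 2 * qd * |u| ≠ 0 :=
    mul_ne_zero hD5 hua
  have hnum : padicValRat p ((8 : ℚ) * (I : ℚ) ^ 2) = 2 * padicValNat p I := by
    rw [padicValRat.mul (by norm_num) (pow_ne_zero _ hI'), padicValRat.pow, h8, padicValRat.of_nat]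
    push_cast; ring
  have hden : padicValRat p ((n : ℚ) * (m : ℚ) * (tK : ℚ) ^ 2 * (cM : ℚ) ^ 2 * (w : ℚ) ^ 2 *
      qd * |u|) = 2 * padicValNat p tK + 2 * padicValInt p cM + padicValRat p qd := by
    rw [padicValRat.mul hD5 hua, padicValRat.mul hD4 hqd0, padicValRat.mul hD3 (pow_ne_zero _ hw'),
      padicValRat.mul hD2 (pow_ne_zero _ hcM), padicValRat.mul hD1 (pow_ne_zero _ htKq),
      padicValRat.mul hn' hm', padicValRat.pow, padicValRat.pow, padicValRat.pow, hvn, hvm, hvw,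
      hvu, padicValRat.of_nat, padicValRat.of_int]
    push_cast; ring
  rw [hqQ, hQ_def, padicValRat.div hA1 hD6, hnum, hden]
  ring

end Summit.BirchSwinnertonDyer.Rank1Residual

end
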